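import Literature.Analysis.InverseSpectral.KreinStringGreen
import HarnessLib

/-!
# Kreĭn strings: existence of the principal Titchmarsh–Weyl function off `[0, ∞)`

For a Kreĭn string `S[m, L]` other than the free half-line and every `z ∈ ℂ ∖ [0, ∞)` the limit

  `q_S(z) = lim_{x → L} ψ(x, z)/φ(x, z)`

exists (`tendsto_principalWeylFunction`), i.e. the first half of part (i) of Kreĭn's theorem
(`KreinInverseSpectralTheorem`). The proof is elementary and uniform in all cases (regular or
singular end, limit-point or limit-circle): with `φ⁺' = -z Φ`, `Φ(t) = ∫_{[0,t]} φ dm`, one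
integration by parts gives the **energy identity**

  `conj φ(x,z) · φ⁺'(x,z) = T(x) - z M(x)`,
  `T(x) = ∫₀ˣ |φ⁺'|² dt ≥ 0`, `M(x) = ∫_{[0,x]} |φ|² dm ≥ 0`

(`conj_phi_mul_deriv_eq`); since `z ∉ [0,∞)` there is `c > 0` with `|a - z b| ≥ c (a + b)` for
all `a, b ≥ 0` (`exists_cone_constant`), whence `|φ(t)|⁻² ≤ |φ⁺'(t)|² / (c² (T(t) + M₀)²)` for
`t ≥ x₀` (`M₀ = M(x₀) > 0`) and, integrating the exact derivative,
`|∫ₓ^{x'} φ⁻²| ≤ c⁻² ((T(x)+M₀)⁻¹ - (T(x')+M₀)⁻¹)`. As `ψ/φ = ∫₀ˣ φ⁻²`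
(`psi_div_phi_eq_integral_of_mem_offNonnegAxis`), the quotients are Cauchy along the end filter.

## References

KacKrein1974 (§2, §10), Tomisaki1988 (§4), DymMcKean1976 (Ch. 5).
-/

open MeasureTheory Filter Set Topology
open scoped ENNReal Nat ComplexConjugate

noncomputable section

namespace Literature.Analysis.InverseSpectral

/-- **Cone constant.** For `z ∈ ℂ ∖ [0, ∞)` there is `c > 0` with `c (a + b) ≤ |a - z b|` for all
real `a, b ≥ 0` (the closed convex cone `{a - z b : a, b ≥ 0}` avoids `0`). [folklore] -/
theorem exists_cone_constant {z : ℂ} (hz : z ∈ offNonnegAxis) :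
    ∃ c : ℝ, 0 < c ∧ ∀ a b : ℝ, 0 ≤ a → 0 ≤ b → c * (a + b) ≤ ‖(a : ℂ) - z * b‖ := by
  have hre_le : ∀ a b : ℝ, |a - z.re * b| ≤ ‖(a : ℂ) - z * b‖ := fun a b => by
    have h := Complex.abs_re_le_norm ((a : ℂ) - z * b)
    simpa using h
  have him_le : ∀ a b : ℝ, |z.im * b| ≤ ‖(a : ℂ) - z * b‖ := fun a b => by
    have h := Complex.abs_im_le_norm ((a : ℂ) - z * b)
    simpa using h
  rcases le_or_gt z.re 0 with hzr | hzr
  · -- `Re z ≤ 0`: `|a - z b| ≥ max (a, |z| b) ≥ min(1,|z|) (a+b)/2`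
    have hz0 : 0 < ‖z‖ := by
      refine norm_pos_iff.2 (fun h => ?_)
      rw [h, mem_offNonnegAxis] at hz
      simp at hz
    refine ⟨min 1 ‖z‖ / 2, by positivity, fun a b ha hb => ?_⟩
    have h1 : a ≤ ‖(a : ℂ) - z * b‖ := by
      refine le_trans ?_ (hre_le a b)
      rw [abs_of_nonneg (by nlinarith)]
      nlinarith
    have h2 : ‖z‖ * b ≤ ‖(a : ℂ) - z * b‖ := by
      refine le_of_pow_le_pow_left₀ two_ne_zero (norm_nonneg _) ?_
      have hw : ‖(a : ℂ) - z * b‖ ^ 2 = (a - z.re * b) ^ 2 + (z.im * b) ^ 2 := by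
        rw [Complex.sq_norm, Complex.normSq_apply]
        simp
        ring
      have hzn : ‖z‖ ^ 2 = z.re ^ 2 + z.im ^ 2 := by
        rw [Complex.sq_norm, Complex.normSq_apply]; ring
      rw [mul_pow, hw, hzn]
      nlinarith [mul_nonneg (neg_nonneg.2 hzr) hb, mul_nonneg ha hb]
    have hmin1 : min 1 ‖z‖ * a ≤ a := by nlinarith [min_le_left 1 ‖z‖, ha]
    have hmin2 : min 1 ‖z‖ * b ≤ ‖z‖ * b := by nlinarith [min_le_right 1 ‖z‖, hb]
    nlinarith [hmin1, hmin2, h1, h2]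
  · -- `Re z > 0`, hence `Im z ≠ 0`
    have hzi : z.im ≠ 0 := by
      rcases hz with h | h
      · exact h
      · exact absurd h (not_lt.2 hzr.le)
    have hzi' : 0 < |z.im| := abs_pos.2 hzi
    set κ := |z.im| / (4 * (z.re + 1)) with hκ
    have hκ0 : 0 < κ := by positivity
    refine ⟨min κ (1 / 2), by positivity, fun a b ha hb => ?_⟩
    have hab : 0 ≤ a + b := by positivity
    rcases le_or_gt (κ * (a + b)) (|z.im| * b) with h | h
    · -- the imaginary part is large
      have h3 : |z.im| * b ≤ ‖(a : ℂ) - z * b‖ := by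
        refine le_trans ?_ (him_le a b)
        rw [abs_mul, abs_of_nonneg hb]
      nlinarith [min_le_left κ (1 / 2), hab]
    · -- `b` is small, so the real part is large
      have hb4 : b * (4 * (z.re + 1)) < a + b := by
        have h' : |z.im| * b < |z.im| * ((a + b) / (4 * (z.re + 1))) := by
          calc |z.im| * b < κ * (a + b) := h
            _ = |z.im| * ((a + b) / (4 * (z.re + 1))) := by rw [hκ]; ring
        have h'' := lt_of_mul_lt_mul_left h' hzi'.le
        rwa [lt_div_iff₀ (by positivity)] at h''
      have hre' : (a + b) / 2 ≤ a - z.re * b := by nlinarith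
      have h3 : (a + b) / 2 ≤ ‖(a : ℂ) - z * b‖ :=
        (hre'.trans (le_abs_self _)).trans (hre_le a b)
      nlinarith [min_le_right κ (1 / 2), hab]

namespace KreinString

variable (S : KreinString)

/-- **Energy identity.** With `Φ(t) = ∫_{[0,t]} φ(·,z) dm` (so that `φ⁺' = -z Φ`):
`conj φ(x,z) · (-z Φ(x)) = ∫₀ˣ |z Φ(t)|² dt - z ∫_{[0,x]} |φ(u,z)|² dm(u)` for `x ∈ [0, L)`
(integration by parts: `conj φ · φ⁺' = ∫ |φ⁺'|² dt + ∫ conj φ d(φ⁺')`). [cite: KacKrein1974, §2] -/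
theorem conj_phi_mul_deriv_eq (z : ℂ) {x : ℝ} (hx : x ∈ S.dom) :
    conj (S.phi z x) * (-z * ∫ u in Icc 0 x, S.phi z u ∂S.massMeasure) =
      ((∫ t in Icc 0 x, ‖z * ∫ u in Icc 0 t, S.phi z u ∂S.massMeasure‖ ^ 2 : ℝ) : ℂ) -
        z * ((∫ u in Icc 0 x, ‖S.phi z u‖ ^ 2 ∂S.massMeasure : ℝ) : ℂ) := by
  have h := (S.isSolution_phi (conj z)).mul_deriv_eq (S.isSolution_phi z) hx
  have hconj : ∀ t, ∫ u in Icc 0 t, S.phi (conj z) u ∂S.massMeasure =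
      conj (∫ u in Icc 0 t, S.phi z u ∂S.massMeasure) := fun t => by
    rw [← integral_conj]
    exact integral_congr_ae (ae_of_all _ fun u => (S.conj_phi z u).symm)
  simp only [hconj, ← S.conj_phi z x, zero_sub, mul_zero, zero_add] at h
  rw [neg_mul, h]
  have hT : ∫ t in Icc 0 x, -(conj z * conj (∫ u in Icc 0 t, S.phi z u ∂S.massMeasure)) *
      -(z * ∫ u in Icc 0 t, S.phi z u ∂S.massMeasure) =
      ((∫ t in Icc 0 x, ‖z * ∫ u in Icc 0 t, S.phi z u ∂S.massMeasure‖ ^ 2 : ℝ) : ℂ) := by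
    rw [← integral_complex_ofReal]
    refine integral_congr_ae (ae_of_all _ fun t => ?_)
    dsimp only
    rw [neg_mul_neg, ← map_mul, mul_comm, Complex.mul_conj, Complex.normSq_eq_norm_sq]
  have hM : ∫ u in Icc 0 x, S.phi (conj z) u * S.phi z u ∂S.massMeasure =
      ((∫ u in Icc 0 x, ‖S.phi z u‖ ^ 2 ∂S.massMeasure : ℝ) : ℂ) := by
    rw [← S.integral_mul_conj_eq]
    refine integral_congr_ae (ae_of_all _ fun u => ?_)
    dsimp only
    rw [← S.conj_phi, mul_comm]
  rw [hT, hM]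

/-- The Stieltjes primitive `Φ(t) = ∫_{[0,t]} φ(·,z) dm` is bounded on `[0, x]`, `x ∈ [0, L)`, and
`t ↦ |z Φ(t)|²` is Lebesgue-integrable there. [folklore] -/
lemma integrableOn_norm_deriv_sq (z : ℂ) {x : ℝ} (hx : x ∈ S.dom) :
    IntegrableOn (fun t => ‖z * ∫ u in Icc 0 t, S.phi z u ∂S.massMeasure‖ ^ 2) (Icc 0 x) := by
  have hμ : S.massMeasure (Icc 0 x) ≠ ⊤ := (S.massMeasure_Icc_lt_top hx).ne
  haveI : IsFiniteMeasure ((volume : Measure ℝ).restrict (Icc 0 x)) :=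
    isFiniteMeasure_restrict.2 measure_Icc_lt_top.ne
  have hφi : IntegrableOn (S.phi z) (Icc 0 x) S.massMeasure :=
    S.integrableOn_Icc_of_continuousOn hx ((S.isSolution_phi z).1.mono (S.Icc_subset_dom hx))
  have hΦi := integrableOn_integral_Icc hμ hφi
  refine Integrable.mono' (g := fun _ => (‖z‖ * ∫ u in Icc 0 x, ‖S.phi z u‖ ∂S.massMeasure) ^ 2)
    (integrable_const _)
    ((continuous_pow 2).comp_aestronglyMeasurable (hΦi.const_mul z).aestronglyMeasurable.norm) ?_
  refine ae_restrict_of_forall_mem measurableSet_Icc (fun t ht => ?_)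
  rw [Real.norm_eq_abs, abs_of_nonneg (by positivity), norm_mul]
  have h := norm_setIntegral_Icc_le hφi ht
  have h0 : 0 ≤ ‖∫ u in Icc 0 t, S.phi z u ∂S.massMeasure‖ := norm_nonneg _
  gcongr

/-- **The energy inequality.** For `z ∈ ℂ ∖ [0, ∞)` with cone constant `c` and `t ∈ [0, L)`:
`c (T(t) + M(t)) ≤ |φ(t,z)| · |z Φ(t)|`, where `T(t) = ∫₀ᵗ |z Φ|² ds`, `M(t) = ∫_{[0,t]} |φ|² dm`.
[cite: KacKrein1974, §2] -/
theorem cone_mul_energy_le (z : ℂ) {c : ℝ}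
    (hc : ∀ a b : ℝ, 0 ≤ a → 0 ≤ b → c * (a + b) ≤ ‖(a : ℂ) - z * b‖) {t : ℝ} (ht : t ∈ S.dom) :
    c * ((∫ s in Icc 0 t, ‖z * ∫ u in Icc 0 s, S.phi z u ∂S.massMeasure‖ ^ 2) +
        ∫ u in Icc 0 t, ‖S.phi z u‖ ^ 2 ∂S.massMeasure) ≤
      ‖S.phi z t‖ * ‖z * ∫ u in Icc 0 t, S.phi z u ∂S.massMeasure‖ := by
  have h := S.conj_phi_mul_deriv_eq z ht
  have hn := congrArg (fun w : ℂ => ‖w‖) h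
  rw [norm_mul, Complex.norm_conj, neg_mul, norm_neg] at hn
  rw [hn]
  exact hc _ _ (integral_nonneg fun _ => by positivity) (integral_nonneg fun _ => by positivity)

/-- The right derivative of the energy `T(t) = ∫₀ᵗ |z Φ(s)|² ds` is `|z Φ(t)|²` at every
`t ∈ [0, L)` (`Φ` is right-continuous). [folklore] -/
theorem hasDerivWithinAt_energy (z : ℂ) {t : ℝ} (ht : t ∈ S.dom) :
    HasDerivWithinAt
      (fun t => ∫ s in (0 : ℝ)..t, ‖z * ∫ u in Icc 0 s, S.phi z u ∂S.massMeasure‖ ^ 2)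
      (‖z * ∫ u in Icc 0 t, S.phi z u ∂S.massMeasure‖ ^ 2) (Ici t) t := by
  obtain ⟨x₀, hx₀, htx₀⟩ := S.exists_mem_dom_gt ht
  have hφi : IntegrableOn (S.phi z) (Icc 0 x₀) S.massMeasure :=
    S.integrableOn_Icc_of_continuousOn hx₀ ((S.isSolution_phi z).1.mono (S.Icc_subset_dom hx₀))
  have hgi := S.integrableOn_norm_deriv_sq z hx₀
  have ht' : t ∈ Ico 0 x₀ := ⟨ht.1, htx₀⟩
  refine intervalIntegral.integral_hasDerivWithinAt_right ?_ ?_ ?_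
  · exact (intervalIntegrable_iff_integrableOn_Ioc_of_le ht.1).2
      (hgi.mono_set (Ioc_subset_Icc_self.trans (Icc_subset_Icc_right htx₀.le)))
  · exact _root_.AEStronglyMeasurable.stronglyMeasurableAtFilter_of_mem hgi.aestronglyMeasurable
      (mem_of_superset (Ioo_mem_nhdsGT htx₀) (fun u hu => ⟨ht.1.trans hu.1.le, hu.2.le⟩))
  · exact (((continuousWithinAt_Ioi_integral_Icc hφi ht').const_mul z).norm).pow 2

/-- **Tail estimate for `∫ φ⁻²`.** Let `z ∈ ℂ ∖ [0, ∞)` with cone constant `c > 0`, let the string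
carry mass on `[0, x₀]` and put `M₀ = ∫_{[0,x₀]} |φ(·,z)|² dm > 0`,
`T(t) = ∫₀ᵗ |z Φ(s)|² ds`. Then for `x₀ ≤ x ≤ x' < L`,
`|∫ₓ^{x'} φ(t,z)⁻² dt| ≤ c⁻² ((T(x) + M₀)⁻¹ - (T(x') + M₀)⁻¹)`. [folklore] -/
theorem norm_integral_inv_phi_sq_le {z : ℂ} (hz : z ∈ offNonnegAxis) {c : ℝ} (hc0 : 0 < c)
    (hc : ∀ a b : ℝ, 0 ≤ a → 0 ≤ b → c * (a + b) ≤ ‖(a : ℂ) - z * b‖)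
    {x₀ x x' : ℝ} (hx₀ : 0 ≤ x₀) (hx₀x : x₀ ≤ x) (hxx' : x ≤ x') (hx' : x' ∈ S.dom)
    (hM₀ : 0 < ∫ u in Icc 0 x₀, ‖S.phi z u‖ ^ 2 ∂S.massMeasure) :
    ‖∫ t in x..x', ((S.phi z t) ^ 2)⁻¹‖ ≤ (c ^ 2)⁻¹ *
      (((∫ s in (0 : ℝ)..x, ‖z * ∫ u in Icc 0 s, S.phi z u ∂S.massMeasure‖ ^ 2) +
          ∫ u in Icc 0 x₀, ‖S.phi z u‖ ^ 2 ∂S.massMeasure)⁻¹ -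
        ((∫ s in (0 : ℝ)..x', ‖z * ∫ u in Icc 0 s, S.phi z u ∂S.massMeasure‖ ^ 2) +
          ∫ u in Icc 0 x₀, ‖S.phi z u‖ ^ 2 ∂S.massMeasure)⁻¹) := by
  -- abbreviations `Φ`, `T`, `M₀`
  obtain ⟨Φ, hΦ⟩ : ∃ Φ : ℝ → ℂ, Φ = fun t => ∫ u in Icc 0 t, S.phi z u ∂S.massMeasure := ⟨_, rfl⟩
  have hΦt : ∀ t, ∫ u in Icc 0 t, S.phi z u ∂S.massMeasure = Φ t := fun t => by rw [hΦ]
  obtain ⟨T, hT⟩ : ∃ T : ℝ → ℝ, T = fun t => ∫ s in (0 : ℝ)..t, ‖z * Φ s‖ ^ 2 := ⟨_, rfl⟩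
  have hTt : ∀ t, ∫ s in (0 : ℝ)..t, ‖z * Φ s‖ ^ 2 = T t := fun t => by rw [hT]
  simp only [hΦt, hTt]
  set M₀ := ∫ u in Icc 0 x₀, ‖S.phi z u‖ ^ 2 ∂S.massMeasure with hM₀def
  -- membership
  have hxd : x ∈ S.dom := ⟨hx₀.trans hx₀x, (ENNReal.ofReal_le_ofReal hxx').trans_lt hx'.2⟩
  have hdom : ∀ t ∈ Icc x x', t ∈ S.dom := fun t ht =>
    ⟨hxd.1.trans ht.1, (ENNReal.ofReal_le_ofReal ht.2).trans_lt hx'.2⟩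
  have hφc : ContinuousOn (S.phi z) (Icc x x') :=
    (S.isSolution_phi z).1.mono (fun t ht => hdom t ht)
  have hφ0 : ∀ t ∈ Icc x x', S.phi z t ≠ 0 := fun t ht =>
    S.phi_ne_zero_of_mem_offNonnegAxis hz (hdom t ht)
  -- `T` as a set integral, `T ≥ 0`
  have hgi : IntegrableOn (fun s => ‖z * Φ s‖ ^ 2) (Icc 0 x') := by
    have h := S.integrableOn_norm_deriv_sq z hx'
    simp only [hΦt] at h
    exact h
  have hT_Icc : ∀ t, 0 ≤ t → T t = ∫ s in Icc 0 t, ‖z * Φ s‖ ^ 2 := fun t ht0 => by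
    rw [← hTt, intervalIntegral.integral_of_le ht0, integral_Icc_eq_integral_Ioc]
  have hT0 : ∀ t, 0 ≤ t → 0 ≤ T t := fun t ht0 => by
    rw [hT_Icc t ht0]
    exact integral_nonneg fun _ => by positivity
  -- the energy inequality on `[x, x']`, with `M(t) ≥ M₀`
  have hkey : ∀ t ∈ Icc x x', c * (T t + M₀) ≤ ‖S.phi z t‖ * ‖z * Φ t‖ := by
    intro t ht
    have htd := hdom t ht
    have h := S.cone_mul_energy_le z hc htd
    simp only [hΦt] at h
    rw [← hT_Icc t htd.1] at h
    have hM : M₀ ≤ ∫ u in Icc 0 t, ‖S.phi z u‖ ^ 2 ∂S.massMeasure :=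
      setIntegral_mono_set (S.integrableOn_Icc_of_continuousOn htd
        (((S.isSolution_phi z).1.mono (S.Icc_subset_dom htd)).norm.pow 2))
        (ae_of_all _ fun _ => by positivity) (Icc_subset_Icc_right (hx₀x.trans ht.1)).eventuallyLE
    nlinarith
  -- pointwise bound on the integrand
  have hpt : ∀ t ∈ Icc x x', ‖((S.phi z t) ^ 2)⁻¹‖ ≤ ‖z * Φ t‖ ^ 2 / (c * (T t + M₀)) ^ 2 := by
    intro t ht
    have hA : 0 < ‖S.phi z t‖ := norm_pos_iff.2 (hφ0 t ht)
    have hTt0 := hT0 t (hdom t ht).1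
    have hD : 0 < c * (T t + M₀) := by positivity
    have hk := hkey t ht
    rw [norm_inv, norm_pow, inv_eq_one_div, div_le_div_iff₀ (by positivity) (by positivity),
      one_mul]
    have hB : 0 ≤ ‖z * Φ t‖ := norm_nonneg _
    calc (c * (T t + M₀)) ^ 2 ≤ (‖S.phi z t‖ * ‖z * Φ t‖) ^ 2 := by gcongr
      _ = ‖z * Φ t‖ ^ 2 * ‖S.phi z t‖ ^ 2 := by ring
  -- the derivative of `t ↦ -(T t + M₀)⁻¹` from the right
  have hderiv : ∀ t ∈ Ioo x x', HasDerivWithinAt (fun t => -(T t + M₀)⁻¹)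
      (‖z * Φ t‖ ^ 2 / (T t + M₀) ^ 2) (Ioi t) t := by
    intro t ht
    have htd := hdom t ⟨ht.1.le, ht.2.le⟩
    have h1 := S.hasDerivWithinAt_energy z htd
    simp only [hΦt, hTt] at h1
    have hne : T t + M₀ ≠ 0 := by have := hT0 t htd.1; positivity
    have h2 := ((h1.add_const M₀).inv hne).neg
    refine (h2.mono (Ioi_subset_Ici_self (a := t))).congr_deriv ?_
    rw [neg_div, neg_neg]
  -- continuity of `t ↦ -(T t + M₀)⁻¹` on `[x, x']`
  have hTc : ContinuousOn T (Icc x x') := by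
    have h := intervalIntegral.continuousOn_primitive_interval (μ := volume) (a := 0) (b := x')
      (f := fun s => ‖z * Φ s‖ ^ 2) (by rw [uIcc_of_le hx'.1]; exact hgi)
    rw [uIcc_of_le hx'.1] at h
    simp only [hTt] at h
    exact h.mono (Icc_subset_Icc_left hxd.1)
  have hGc : ContinuousOn (fun t => -(T t + M₀)⁻¹) (Icc x x') :=
    ((hTc.add continuousOn_const).inv₀ (fun t ht => by
      have := hT0 t (hdom t ht).1
      show T t + M₀ ≠ 0
      positivity)).neg
  -- integrability of the majorants
  have hmaj : ∀ {k : ℝ}, 0 < k → IntervalIntegrable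
      (fun t => ‖z * Φ t‖ ^ 2 / (k * (T t + M₀)) ^ 2) volume x x' := by
    intro k hk
    rw [intervalIntegrable_iff_integrableOn_Icc_of_le hxx']
    have hcont : ContinuousOn (fun t => ((k * (T t + M₀)) ^ 2)⁻¹) (Icc x x') :=
      ((continuousOn_const.mul (hTc.add continuousOn_const)).pow 2).inv₀ (fun t ht => by
        have := hT0 t (hdom t ht).1
        show (k * (T t + M₀)) ^ 2 ≠ 0
        positivity)
    exact ((hgi.mono_set (Icc_subset_Icc_left hxd.1)).mul_continuousOn hcont
      isCompact_Icc).congr_fun (fun t _ => (div_eq_mul_inv _ _).symm) measurableSet_Icc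
  -- the fundamental theorem of calculus for right derivatives
  have hFTC : ∫ t in x..x', ‖z * Φ t‖ ^ 2 / (T t + M₀) ^ 2 = (T x + M₀)⁻¹ - (T x' + M₀)⁻¹ := by
    have h := intervalIntegral.integral_eq_sub_of_hasDeriv_right_of_le hxx' hGc hderiv
      (by simpa using hmaj one_pos)
    rw [h]
    ring
  have hint1 : IntervalIntegrable (fun t => ‖((S.phi z t) ^ 2)⁻¹‖) volume x x' :=
    ((hφc.pow 2).inv₀ (fun t ht => pow_ne_zero 2 (hφ0 t ht))).norm.intervalIntegrable_of_Icc hxx'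
  have hc' : c ≠ 0 := hc0.ne'
  calc ‖∫ t in x..x', ((S.phi z t) ^ 2)⁻¹‖
      ≤ ∫ t in x..x', ‖((S.phi z t) ^ 2)⁻¹‖ := intervalIntegral.norm_integral_le_integral_norm hxx'
    _ ≤ ∫ t in x..x', ‖z * Φ t‖ ^ 2 / (c * (T t + M₀)) ^ 2 :=
        intervalIntegral.integral_mono_on hxx' hint1 (hmaj hc0) hpt
    _ = (c ^ 2)⁻¹ * ∫ t in x..x', ‖z * Φ t‖ ^ 2 / (T t + M₀) ^ 2 := by
        rw [← intervalIntegral.integral_const_mul]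
        refine intervalIntegral.integral_congr (fun t _ => ?_)
        simp only [mul_pow]
        rw [div_mul_eq_div_div, div_eq_mul_inv _ (c ^ 2), mul_comm]
        ring
    _ = _ := by rw [hFTC]

/-- The tail of `[0, L)` beyond a point `x₁ ∈ [0, L)` belongs to the end filter. [folklore] -/
lemma Ici_inter_dom_mem_toEnd {x₁ : ℝ} (hx₁ : x₁ ∈ S.dom) : {x | x ∈ S.dom ∧ x₁ ≤ x} ∈ S.toEnd := by
  unfold toEnd
  split_ifs with hL
  · exact mem_of_superset (mem_atTop x₁) (fun x hx => ⟨⟨hx₁.1.trans hx, by simp [hL]⟩, hx⟩)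
  · have hx₁L : x₁ < S.length.toReal := (ENNReal.ofReal_lt_iff_lt_toReal hx₁.1 hL).1 hx₁.2
    refine mem_of_superset (Ico_mem_nhdsLT hx₁L) (fun x hx => ⟨⟨hx₁.1.trans hx.1, ?_⟩, hx.1⟩)
    exact (ENNReal.ofReal_lt_iff_lt_toReal (hx₁.1.trans hx.1) hL).2 hx.2

/-- `∫₀ˣ |φ(·,z)|² dm > 0` as soon as `dm([0,x]) > 0` (`z ∉ [0, ∞)`, so `φ` has no zeros).
[folklore] -/
lemma integral_norm_phi_sq_pos {z : ℂ} (hz : z ∈ offNonnegAxis) {x : ℝ} (hx : x ∈ S.dom)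
    (hμ : 0 < S.massMeasure (Icc 0 x)) : 0 < ∫ u in Icc 0 x, ‖S.phi z u‖ ^ 2 ∂S.massMeasure := by
  have hφc : ContinuousOn (fun u => ‖S.phi z u‖ ^ 2) (Icc 0 x) :=
    (((S.isSolution_phi z).1.mono (S.Icc_subset_dom hx)).norm).pow 2
  obtain ⟨t₀, ht₀, hmin⟩ := isCompact_Icc.exists_isMinOn ⟨0, left_mem_Icc.2 hx.1⟩ hφc
  have hδ : 0 < ‖S.phi z t₀‖ ^ 2 :=
    pow_pos (norm_pos_iff.2 (S.phi_ne_zero_of_mem_offNonnegAxis hz (S.Icc_subset_dom hx ht₀))) 2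
  have h := setIntegral_ge_of_const_le (measurableSet_Icc (a := (0 : ℝ)) (b := x))
    (S.massMeasure_Icc_lt_top hx).ne (fun u hu => hmin hu)
    (S.integrableOn_Icc_of_continuousOn hx hφc)
  refine lt_of_lt_of_le ?_ h
  rw [smul_eq_mul, measureReal_def]
  exact mul_pos (ENNReal.toReal_pos hμ.ne' (S.massMeasure_Icc_lt_top hx).ne) hδ

/-- In the absence of mass on `[0, x]`, `φ(·, z) ≡ 1` there. [folklore] -/
lemma phi_eq_one_of_massMeasure_Icc_eq_zero (z : ℂ) {x : ℝ} (hx : x ∈ S.dom)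
    (hμ : S.massMeasure (Icc 0 x) = 0) : S.phi z x = 1 := by
  rw [S.phi_eq_one_sub_integral z hx]
  have h0 : ∀ t ∈ Icc 0 x, ∫ u in Icc 0 t, S.phi z u ∂S.massMeasure = 0 := fun t ht => by
    have : S.massMeasure (Icc 0 t) = 0 := measure_mono_null (Icc_subset_Icc_right ht.2) hμ
    rw [Measure.restrict_eq_zero.2 this, integral_zero_measure]
  rw [setIntegral_congr_fun measurableSet_Icc h0]
  simp

/-- **Existence of the principal Titchmarsh–Weyl function** (part (i) of Kreĭn's theorem, first
half): for every Kreĭn string other than the free half-line `S[0, ∞]` and every `z ∈ ℂ ∖ [0, ∞)`,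
`ψ(x, z)/φ(x, z)` converges as `x → L`. [cite: KacKrein1974, §2] -/
theorem exists_tendsto_psi_div_phi (hS : ¬ S.IsTrivial) {z : ℂ} (hz : z ∈ offNonnegAxis) :
    ∃ q : ℂ, Tendsto (fun x => S.psi z x / S.phi z x) S.toEnd (𝓝 q) := by
  haveI := S.toEnd_neBot
  by_cases hmass : ∃ x₀ ∈ S.dom, 0 < S.massMeasure (Icc 0 x₀)
  · -- the string carries mass on some `[0, x₀]`
    obtain ⟨x₀, hx₀, hμ0⟩ := hmass
    obtain ⟨c, hc0, hc⟩ := exists_cone_constant hz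
    have hM₀ := S.integral_norm_phi_sq_pos hz hx₀ hμ0
    set M₀ := ∫ u in Icc 0 x₀, ‖S.phi z u‖ ^ 2 ∂S.massMeasure with hM₀def
    -- the energy `T` and the modulus `G = (T + M₀)⁻¹`
    obtain ⟨T, hT⟩ : ∃ T : ℝ → ℝ, T = fun t =>
        ∫ s in (0 : ℝ)..t, ‖z * ∫ u in Icc 0 s, S.phi z u ∂S.massMeasure‖ ^ 2 := ⟨_, rfl⟩
    have hTt : ∀ t, ∫ s in (0 : ℝ)..t, ‖z * ∫ u in Icc 0 s, S.phi z u ∂S.massMeasure‖ ^ 2 = T t :=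
      fun t => by rw [hT]
    have hT0 : ∀ t, 0 ≤ t → 0 ≤ T t := fun t ht0 => by
      rw [← hTt]
      exact intervalIntegral.integral_nonneg ht0 (fun s _ => by positivity)
    have hTmono : ∀ {t t' : ℝ}, 0 ≤ t → t ≤ t' → t' ∈ S.dom → T t ≤ T t' := by
      intro t t' ht0 htt' ht'
      rw [← hTt, ← hTt]
      exact intervalIntegral.integral_mono_interval le_rfl ht0 htt'
        (ae_of_all _ fun _ => by positivity)
        ((intervalIntegrable_iff_integrableOn_Icc_of_le (ht0.trans htt')).2
          (S.integrableOn_norm_deriv_sq z ht'))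
    -- the quotient and its increments
    have hcontIcc : ∀ {a b : ℝ}, 0 ≤ a → b ∈ S.dom →
        ContinuousOn (fun t => ((S.phi z t) ^ 2)⁻¹) (Icc a b) := by
      intro a b ha hb
      have hsub : Icc a b ⊆ S.dom := fun t ht =>
        ⟨ha.trans ht.1, (ENNReal.ofReal_le_ofReal ht.2).trans_lt hb.2⟩
      exact (((S.isSolution_phi z).1.mono hsub).pow 2).inv₀ (fun t ht =>
        pow_ne_zero 2 (S.phi_ne_zero_of_mem_offNonnegAxis hz (hsub ht)))
    set Q : ℝ → ℂ := fun x => S.psi z x / S.phi z x with hQ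
    have hQint : ∀ {x x' : ℝ}, 0 ≤ x → x ≤ x' → x' ∈ S.dom →
        Q x' - Q x = ∫ t in x..x', ((S.phi z t) ^ 2)⁻¹ := by
      intro x x' hx0 hxx' hx'
      have hxd : x ∈ S.dom := ⟨hx0, (ENNReal.ofReal_le_ofReal hxx').trans_lt hx'.2⟩
      simp only [hQ]
      rw [S.psi_div_phi_eq_integral_of_mem_offNonnegAxis hz hxd,
        S.psi_div_phi_eq_integral_of_mem_offNonnegAxis hz hx',
        ← intervalIntegral.integral_add_adjacent_intervals (b := x)
          ((hcontIcc le_rfl hxd).intervalIntegrable_of_Icc hx0)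
          ((hcontIcc hx0 hx').intervalIntegrable_of_Icc hxx')]
      ring
    -- the tail bound
    have htail : ∀ {x x' : ℝ}, x₀ ≤ x → x ≤ x' → x' ∈ S.dom →
        ‖Q x' - Q x‖ ≤ (c ^ 2)⁻¹ * ((T x + M₀)⁻¹ - (T x' + M₀)⁻¹) := by
      intro x x' hx₀x hxx' hx'
      rw [hQint (hx₀.1.trans hx₀x) hxx' hx']
      have h := S.norm_integral_inv_phi_sq_le hz hc0 hc hx₀.1 hx₀x hxx' hx' hM₀
      simp only [hTt] at h
      exact h
    -- `G = (T + M₀)⁻¹` is non-increasing beyond `x₀`; its infimum over the tail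
    have hGanti : ∀ {t t' : ℝ}, x₀ ≤ t → t ≤ t' → t' ∈ S.dom →
        (T t' + M₀)⁻¹ ≤ (T t + M₀)⁻¹ := by
      intro t t' hx₀t htt' ht'
      have h0 := hT0 t (hx₀.1.trans hx₀t)
      exact inv_anti₀ (by positivity) (by linarith [hTmono (hx₀.1.trans hx₀t) htt' ht'])
    set A : Set ℝ := (fun t => (T t + M₀)⁻¹) '' {t | t ∈ S.dom ∧ x₀ ≤ t} with hA
    have hAne : A.Nonempty := ⟨_, ⟨x₀, ⟨hx₀, le_rfl⟩, rfl⟩⟩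
    have hAbdd : BddBelow A := ⟨0, by
      rintro _ ⟨t, ht, rfl⟩
      have := hT0 t ht.1.1
      positivity⟩
    have hGinf : ∀ t ∈ S.dom, x₀ ≤ t → sInf A ≤ (T t + M₀)⁻¹ := fun t ht hx₀t =>
      csInf_le hAbdd ⟨t, ⟨ht, hx₀t⟩, rfl⟩
    -- Cauchy criterion along the end filter
    refine cauchy_map_iff_exists_tendsto.1 ?_
    rw [cauchy_map_iff', Metric.uniformity_basis_dist.tendsto_right_iff]
    intro ε hε
    have hcε : 0 < c ^ 2 * ε := by positivity
    obtain ⟨_, ⟨x₁, ⟨hx₁, hx₀x₁⟩, rfl⟩, hx₁lt⟩ :=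
      exists_lt_of_csInf_lt hAne (show sInf A < sInf A + c ^ 2 * ε by linarith)
    have hsmall : ∀ {x x' : ℝ}, x ∈ S.dom → x' ∈ S.dom → x₁ ≤ x → x ≤ x' →
        dist (Q x) (Q x') < ε := by
      intro x x' hx hx' hx₁x hxx'
      rw [dist_comm, dist_eq_norm]
      have h1 := htail (hx₀x₁.trans hx₁x) hxx' hx'
      have h2 := hGanti hx₀x₁ hx₁x hx
      have h3 := hGinf x' hx' ((hx₀x₁.trans hx₁x).trans hxx')
      have h4 : (c ^ 2)⁻¹ * ((T x + M₀)⁻¹ - (T x' + M₀)⁻¹) < (c ^ 2)⁻¹ * (c ^ 2 * ε) :=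
        mul_lt_mul_of_pos_left (by linarith) (by positivity)
      have h5 : (c ^ 2)⁻¹ * (c ^ 2 * ε) = ε := by field_simp
      linarith
    have hmem := S.Ici_inter_dom_mem_toEnd hx₁
    filter_upwards [Filter.prod_mem_prod hmem hmem] with p hp
    rcases le_total p.1 p.2 with h | h
    · exact hsmall hp.1.1 hp.2.1 hp.1.2 h
    · show dist (Q p.1) (Q p.2) < ε
      rw [dist_comm]
      exact hsmall hp.2.1 hp.1.1 hp.2.2 h
  · -- no mass on any `[0, x]`, `x < L`: then `L < ∞`, `φ ≡ 1`, `ψ/φ = x → L`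
    push Not at hmass
    have hμ0 : ∀ x ∈ S.dom, S.massMeasure (Icc 0 x) = 0 := fun x hx =>
      nonpos_iff_eq_zero.1 (hmass x hx)
    have hL : S.length ≠ ⊤ := by
      intro hL
      obtain ⟨n, hn⟩ := S.exists_mass_pos hL hS
      rw [S.mass_eq_toReal_Icc, hμ0 n ⟨n.cast_nonneg, by simp [hL]⟩, ENNReal.toReal_zero] at hn
      exact lt_irrefl _ hn
    have hL0 : 0 < S.length.toReal := ENNReal.toReal_pos S.length_pos.ne' hL
    refine ⟨(S.length.toReal : ℂ), ?_⟩
    unfold toEnd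
    rw [if_neg hL]
    have hQ : ∀ x ∈ Ioo 0 S.length.toReal, S.psi z x / S.phi z x = x := by
      intro x hx
      have hxd : x ∈ S.dom := ⟨hx.1.le, (ENNReal.ofReal_lt_iff_lt_toReal hx.1.le hL).2 hx.2⟩
      rw [S.psi_div_phi_eq_integral_of_mem_offNonnegAxis hz hxd]
      have h1 : EqOn (fun t => ((S.phi z t) ^ 2)⁻¹) (fun _ => (1 : ℂ)) (uIcc 0 x) := by
        intro t ht
        rw [uIcc_of_le hx.1.le] at ht
        simp only
        rw [S.phi_eq_one_of_massMeasure_Icc_eq_zero z (S.Icc_subset_dom hxd ht)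
          (measure_mono_null (Icc_subset_Icc_right ht.2) (hμ0 x hxd))]
        simp
      rw [intervalIntegral.integral_congr h1]
      simp
    refine Tendsto.congr' ?_ ((Complex.continuous_ofReal.tendsto _).mono_left nhdsWithin_le_nhds)
    exact mem_of_superset (Ioo_mem_nhdsLT hL0) (fun x hx => (hQ x hx).symm)

/-- **Part (i) of Kreĭn's theorem, existence of `q_S`.** For every Kreĭn string other than the free
half-line `S[0, ∞]` and every `z ∈ ℂ ∖ [0, ∞)` the limit `q_S(z) = lim_{x → L} ψ(x,z)/φ(x,z)`
defining the principal Titchmarsh–Weyl function (`KreinString.principalWeylFunction`) exists.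
[cite: KacKrein1974, §2] -/
theorem tendsto_principalWeylFunction (hS : ¬ S.IsTrivial) {z : ℂ} (hz : z ∈ offNonnegAxis) :
    Tendsto (fun x => S.psi z x / S.phi z x) S.toEnd (𝓝 (S.principalWeylFunction z)) := by
  haveI := S.toEnd_neBot
  obtain ⟨q, hq⟩ := S.exists_tendsto_psi_div_phi hS hz
  rw [show S.principalWeylFunction z = q from hq.limUnder_eq]
  exact hq

end KreinString

end Literature.Analysis.InverseSpectral

end
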